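import Literature.AlgebraicGeometry.Frobenioids.IsometricPreStepsPushforward
import Literature.AlgebraicGeometry.Frobenioids.IsometricPreStepsPullback
import HarnessLib

/-!
# Frobenioids I, Proposition 1.11 (v): functoriality of the equivalences of Def. 1.3 (iii)(d)

Mochizuki, *The geometry of Frobenioids I: the general theory*, Kyushu J. Math. **62** (2008)
293–400, §1, Proposition 1.11 (v) and its proof, kurims text pp. 37–38
[cite: MochizukiFrdI2008, Prop. 1.11(v)]. Standing data: `C → F_Φ` a Frobenioid (`hF`).

> "(v) The equivalences of categories of Definition 1.3, (iii), (d), are 'functorial' in the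
> following sense: If `φ : A → B` is an arbitrary morphism of `C^lin`, `α : C → A` and `β : D → B`
> (respectively, `α : A → C` and `β : B → D`) are co-angular pre-steps such that
> `(α_*)⁻¹(Div(α)) = φ^*{(β_*)⁻¹(Div(β))}` (respectively, `Div(α) = φ^*(Div(β))`), then there
> exists a unique morphism `ψ : C → D` in `C^lin` such that `β ∘ ψ = φ ∘ α` (respectively,
> `ψ ∘ α = β ∘ φ`). Moreover, `φ` is a pull-back morphism if and only if `ψ` is."

PROVED along the printed proof (p. 38): uniqueness since `β` is a monomorphism (resp. `α` an
epimorphism); existence for `φ` a pull-back morphism (Def. 1.3 (i)(c), the definition of a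
pull-back morphism, Prop. 1.7 (v), Def. 1.3 (iii)(d)), an isometric pre-step (the construction of
Prop. 1.9 (ii), resp. Def. 1.3 (v)(b)), a co-angular pre-step (Def. 1.3 (iii)(d)), and in general
by composing these along `φ = q ∘ i ∘ c` (Prop. 1.7 (iii), Def. 1.3 (v)(b)); the "moreover" by
uniqueness and, conversely, Remark 1.1.1 with Prop. 1.4 (ii).

Renderings (recorded for the referee). `φ^*` is `pull Φ (Base φ)`; `(α_*)⁻¹ Div α` is
`invDiv F α`; composition is diagrammatic. No statement of the paper is strengthened.
-/

namespace Literature.AlgebraicGeometry.Frobenioids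

open CategoryTheory Opposite

universe w v v' u u'

namespace PreFrobenioid

variable {D : Type u} [Category.{v} D] {Φ : Dᵒᵖ ⥤ CommMonCat.{w}}
  {C : Type u'} [Category.{v'} C] {F : C ⥤ ElemFrobenioid Φ}

/-! ### Preliminaries -/

/-- Co-angular pre-steps `α : A → X`, `α' : A → X'` under `A` with `Div α = Div α'` are isomorphic
under `A` (coslice equivalence of Def. 1.3 (iii)(d), fullness both ways; `α` is an epimorphism).
[cite: MochizukiFrdI2008, Def. 1.3(iii)] -/
theorem exists_iso_of_div_eq (hF : IsFrobenioid F) {A X X' : C} (α : A ⟶ X) (α' : A ⟶ X')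
    (h : IsCoAngularPreStep F α) (h' : IsCoAngularPreStep F α') (heq : Div F α = Div F α') :
    ∃ e : X ≅ X', α ≫ e.hom = α' := by
  have hC := hF.isPreFrobenioid.isTotallyEpimorphic
  obtain ⟨g, -, hg⟩ := hF.iii_d_under_full α α' h h' (by rw [heq])
  obtain ⟨g', -, hg'⟩ := hF.iii_d_under_full α' α h' h (by rw [heq])
  haveI := hC.epi α
  haveI := hC.epi α'
  have h1 : g ≫ g' = 𝟙 X := by rw [← cancel_epi α, ← Category.assoc, hg, hg', Category.comp_id]
  have h2 : g' ≫ g = 𝟙 X' := by rw [← cancel_epi α', ← Category.assoc, hg', hg, Category.comp_id]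
  exact ⟨⟨g, g', h1, h2⟩, hg⟩

/-- A co-angular linear base-isomorphism is a co-angular pre-step. [cite: MochizukiFrdI2008, Prop. 1.11(v) p.38] -/
theorem isCoAngularPreStep_of_factors (hF : IsFrobenioid F) {X Y Z : C} {g : X ⟶ Y} {h : Y ⟶ Z}
    (hco : IsCoAngular F (g ≫ h)) (hlin : IsLinear F (g ≫ h)) (hb : IsBaseIso F g) :
    IsCoAngularPreStep F g :=
  ⟨(isCoAngular_isLinear_factors F hF hco hlin).2.1, (isLinear_factors F hlin).2, hb⟩

/-! ### The slice case ("non-resp'd"): the three special cases -/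

/-- **Prop. 1.11 (v)**, slice case, `φ` a pull-back morphism: there is a PULL-BACK morphism
`ψ : X → Y` with `β ∘ ψ = φ ∘ α` (Def. 1.3 (i)(c); the definition of a pull-back morphism;
Prop. 1.7 (v); Def. 1.3 (iii)(d)). [cite: MochizukiFrdI2008, Prop. 1.11(v) p.38] -/
theorem exists_pullback_square_over (hF : IsFrobenioid F) {A B X Y : C} {φ : A ⟶ B}
    (hφ : IsPullbackMorphism F φ) (α : X ⟶ A) (β : Y ⟶ B) (hα : IsCoAngularPreStep F α)
    (hβ : IsCoAngularPreStep F β) (hdiv : invDiv F α hα.2.2 = pull Φ (Base F φ) (invDiv F β hβ.2.2)) :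
    ∃ ψ : X ⟶ Y, IsPullbackMorphism F ψ ∧ ψ ≫ β = α ≫ φ := by
  have hP := hF.isPreFrobenioid
  haveI : IsIso (Base F α) := hα.2.2
  haveI : IsIso (Base F β) := hβ.2.2
  obtain ⟨⟨hφco, hφiso⟩, hφlin⟩ := hF.iv_b φ hφ
  -- a pull-back morphism `ψ₁ : X₁ → Y` over `Base α ≫ Base φ ≫ (Base β)⁻¹`
  obtain ⟨X₁, ψ₁, i, hψ₁, hψ₁b⟩ :=
    exists_isPullbackMorphism_over hF Y (Base F α ≫ Base F φ ≫ inv (Base F β))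
  obtain ⟨⟨hψ₁co, hψ₁iso⟩, hψ₁lin⟩ := hF.iv_b ψ₁ hψ₁
  -- lift to `γ : X₁ → A` along `φ`
  obtain ⟨γ, hγ, hγb⟩ := hφ.exists_lift (ψ₁ ≫ β) (i.hom ≫ Base F α) (by
    rw [base_comp, hψ₁b]; simp)
  -- `γ` is a co-angular pre-step with the same `(γ^*)⁻¹ Div γ` as `α`
  have hγco : IsCoAngularPreStep F γ := by
    refine isCoAngularPreStep_of_factors hF (h := φ) ?_ ?_ ?_
    · rw [hγ]; exact hF.iii_a ψ₁ β hψ₁co hβ.1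
    · rw [hγ]; exact IsLinear.comp F hψ₁lin hβ.2.1
    · show IsIso (Base F γ); rw [hγb]; infer_instance
  haveI : IsIso (Base F γ) := hγco.2.2
  have hDγ : Div F γ = pull Φ (Base F ψ₁) (Div F β) := by
    have h1 : Div F (γ ≫ φ) = Div F γ := by
      rw [div_comp, show Div F φ = 1 from hφiso, map_one, one_mul, show degFr F φ = 1 from hφlin,
        PNat.one_coe, pow_one]
    have h2 : Div F (ψ₁ ≫ β) = pull Φ (Base F ψ₁) (Div F β) := by
      rw [div_comp, show Div F ψ₁ = 1 from hψ₁iso, one_pow, mul_one]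
    rw [← h1, hγ, h2]
  have hinv : invDiv F γ hγco.2.2 = invDiv F α hα.2.2 := by
    rw [hdiv]
    show pull Φ (inv (Base F γ)) (Div F γ) = pull Φ (Base F φ) (pull Φ (inv (Base F β)) (Div F β))
    have hm : inv (Base F γ) ≫ Base F ψ₁ = Base F φ ≫ inv (Base F β) := by
      rw [IsIso.inv_comp_eq, hγb, hψ₁b]
      simp
    rw [hDγ, ← pull_comp, ← pull_comp, hm]
  obtain ⟨e, he⟩ := exists_iso_of_invDiv_eq hF γ α hγco hα hinv
  refine ⟨e.inv ≫ ψ₁, IsPullbackMorphism.comp F (isPullbackMorphism_of_isIso F e.inv) hψ₁, ?_⟩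
  rw [Category.assoc, ← hγ, ← he, Category.assoc, e.inv_hom_id_assoc]

/-- **Prop. 1.11 (v)**, slice case, `φ` an isometric pre-step: there is a linear `ψ` with
`β ∘ ψ = φ ∘ α` ("from the equivalence of categories of Proposition 1.9, (ii)", i.e. its
construction). [cite: MochizukiFrdI2008, Prop. 1.11(v) p.38] -/
theorem exists_linear_square_over_of_isIsometricPreStep (hF : IsFrobenioid F) {A B X Y : C}
    {φ : A ⟶ B} (hφ : IsIsometricPreStep F φ) (α : X ⟶ A) (β : Y ⟶ B)
    (hα : IsCoAngularPreStep F α) (hβ : IsCoAngularPreStep F β)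
    (hdiv : invDiv F α hα.2.2 = pull Φ (Base F φ) (invDiv F β hβ.2.2)) :
    ∃ ψ : X ⟶ Y, IsLinear F ψ ∧ ψ ≫ β = α ≫ φ := by
  have hP := hF.isPreFrobenioid
  obtain ⟨X₀, ψ₀, α₀, hψ₀, hα₀, hsq, hx⟩ := exists_square_of_isCoAngularPreStep hF β hβ φ hφ
  obtain ⟨e, he⟩ := exists_iso_of_invDiv_eq hF ψ₀ α hψ₀ hα (by rw [hx, hdiv])
  refine ⟨e.inv ≫ α₀, IsLinear.comp F (isLinear_of_isIso F e.inv) hα₀.2.1, ?_⟩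
  rw [Category.assoc, ← hsq, ← he, Category.assoc, e.inv_hom_id_assoc]

/-- **Prop. 1.11 (v)**, slice case, `φ` a co-angular pre-step: there is a co-angular pre-step `ψ`
with `β ∘ ψ = φ ∘ α` ("follows formally from the equivalences of categories of Definition 1.3,
(iii), (d)"). [cite: MochizukiFrdI2008, Prop. 1.11(v) p.38] -/
theorem exists_linear_square_over_of_isCoAngularPreStep (hF : IsFrobenioid F) {A B X Y : C}
    {φ : A ⟶ B} (hφ : IsCoAngularPreStep F φ) (α : X ⟶ A) (β : Y ⟶ B)
    (hα : IsCoAngularPreStep F α) (hβ : IsCoAngularPreStep F β)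
    (hdiv : invDiv F α hα.2.2 = pull Φ (Base F φ) (invDiv F β hβ.2.2)) :
    ∃ ψ : X ⟶ Y, IsCoAngularPreStep F ψ ∧ ψ ≫ β = α ≫ φ := by
  haveI : IsIso (Base F α) := hα.2.2
  haveI : IsIso (Base F β) := hβ.2.2
  haveI : IsIso (Base F φ) := hφ.2.2
  have hαφ : IsCoAngularPreStep F (α ≫ φ) :=
    ⟨hF.iii_a α φ hα.1 hφ.1, IsPreStep.comp F hα.2 hφ.2⟩
  haveI : IsIso (Base F (α ≫ φ)) := hαφ.2.2
  -- `(β^*)⁻¹ Div β` divides `((α ≫ φ)^*)⁻¹ Div(α ≫ φ) = (φ^*)⁻¹ Div φ · (β^*)⁻¹ Div β`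
  have hdvd : invDiv F β hβ.2.2 ∣ invDiv F (α ≫ φ) hαφ.2.2 := by
    refine ⟨invDiv F φ hφ.2.2, ?_⟩
    show pull Φ (inv (Base F (α ≫ φ))) (Div F (α ≫ φ)) =
      pull Φ (inv (Base F β)) (Div F β) * pull Φ (inv (Base F φ)) (Div F φ)
    have hb : inv (Base F (α ≫ φ)) = inv (Base F φ) ≫ inv (Base F α) := by
      apply IsIso.inv_eq_of_hom_inv_id
      rw [base_comp]
      simp
    rw [hb, div_comp, map_mul, map_pow, show degFr F φ = 1 from hφ.2.1, PNat.one_coe, pow_one,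
      pull_comp, pull_comp, ← pull_comp Φ (inv (Base F α)) (Base F α), IsIso.inv_hom_id, pull_id,
      mul_comm]
    congr 1
    have : pull Φ (inv (Base F α)) (Div F α) = invDiv F α hα.2.2 := rfl
    rw [this, hdiv, ← pull_comp, IsIso.inv_hom_id, pull_id]
    rfl
  obtain ⟨g, hg, hgfac⟩ := hF.iii_d_over_full (α ≫ φ) β hαφ hβ hdvd
  exact ⟨g, hg, hgfac⟩

/-! ### The slice case: general linear `φ`, uniqueness, and the "moreover" -/

/-- **Prop. 1.11 (v)**, slice case, existence for an arbitrary linear `φ` (compose the three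
special cases along `φ = q ∘ i ∘ c`, Prop. 1.7 (iii) and Def. 1.3 (v)(b)).
[cite: MochizukiFrdI2008, Prop. 1.11(v) p.37] -/
theorem exists_linear_square_over (hF : IsFrobenioid F) {A B X Y : C} {φ : A ⟶ B}
    (hφ : IsLinear F φ) (α : X ⟶ A) (β : Y ⟶ B) (hα : IsCoAngularPreStep F α)
    (hβ : IsCoAngularPreStep F β) (hdiv : invDiv F α hα.2.2 = pull Φ (Base F φ) (invDiv F β hβ.2.2)) :
    ∃ ψ : X ⟶ Y, IsLinear F ψ ∧ ψ ≫ β = α ≫ φ := by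
  obtain ⟨A₂, p, q, hpq, hp, hq⟩ := (isLinear_iff_exists_preStep_pullback F hF φ).mp hφ
  obtain ⟨A₁, c, i, hci, hc, hi⟩ := hF.v_b_exists p hp
  -- auxiliary co-angular pre-steps over `A₂` and `A₁`
  obtain ⟨Y₂, β₂, hβ₂, hβ₂x⟩ := hF.iii_d_over_surj A₂ (pull Φ (Base F q) (invDiv F β hβ.2.2))
  obtain ⟨Y₁, β₁, hβ₁, hβ₁x⟩ := hF.iii_d_over_surj A₁ (pull Φ (Base F i) (invDiv F β₂ hβ₂.2.2))
  have hdiv₁ : invDiv F α hα.2.2 = pull Φ (Base F c) (invDiv F β₁ hβ₁.2.2) := by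
    rw [hdiv, hβ₁x, hβ₂x, ← pull_comp, ← pull_comp, ← base_comp, ← base_comp]
    simp only [Category.assoc, reassoc_of% hci, hpq]
  obtain ⟨ψ₁, hψ₁, h₁⟩ := exists_linear_square_over_of_isCoAngularPreStep hF hc α β₁ hα hβ₁ hdiv₁
  obtain ⟨ψ₂, hψ₂, h₂⟩ := exists_linear_square_over_of_isIsometricPreStep hF hi β₁ β₂ hβ₁ hβ₂ hβ₁x
  obtain ⟨ψ₃, hψ₃, h₃⟩ := exists_pullback_square_over hF hq β₂ β hβ₂ hβ hβ₂x
  refine ⟨ψ₁ ≫ ψ₂ ≫ ψ₃, IsLinear.comp F hψ₁.2.1 (IsLinear.comp F hψ₂ (hF.iv_b ψ₃ hψ₃).2), ?_⟩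
  rw [Category.assoc, Category.assoc, h₃, reassoc_of% h₂, reassoc_of% h₁, ← hpq, ← hci,
    Category.assoc]

/-- **Prop. 1.11 (v)**, slice case: uniqueness of `ψ` ("from the fact that `β` is a monomorphism
[cf. Definition 1.3, (v), (a)]"). [cite: MochizukiFrdI2008, Prop. 1.11(v) p.38] -/
theorem square_over_unique (hF : IsFrobenioid F) {A B X Y : C} {φ : A ⟶ B} {α : X ⟶ A}
    {β : Y ⟶ B} (hβ : IsPreStep F β) {ψ ψ' : X ⟶ Y} (h : ψ ≫ β = α ≫ φ) (h' : ψ' ≫ β = α ≫ φ) :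
    ψ = ψ' := by
  haveI := hF.v_a β hβ
  exact (cancel_mono β).mp (h.trans h'.symm)

/-- **Prop. 1.11 (v)**, slice case: existence and uniqueness of the linear `ψ` with
`β ∘ ψ = φ ∘ α`. [cite: MochizukiFrdI2008, Prop. 1.11(v) p.37] -/
theorem existsUnique_linear_square_over (hF : IsFrobenioid F) {A B X Y : C} {φ : A ⟶ B}
    (hφ : IsLinear F φ) (α : X ⟶ A) (β : Y ⟶ B) (hα : IsCoAngularPreStep F α)
    (hβ : IsCoAngularPreStep F β) (hdiv : invDiv F α hα.2.2 = pull Φ (Base F φ) (invDiv F β hβ.2.2)) :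
    ∃! ψ : X ⟶ Y, IsLinear F ψ ∧ ψ ≫ β = α ≫ φ := by
  obtain ⟨ψ, hψ, h⟩ := exists_linear_square_over hF hφ α β hα hβ hdiv
  exact ⟨ψ, ⟨hψ, h⟩, fun ψ' h' => square_over_unique hF hβ.2 h'.2 h⟩

/-- **Prop. 1.11 (v)**, slice case, "Moreover, `φ` is a pull-back morphism if and only if `ψ`
is." [cite: MochizukiFrdI2008, Prop. 1.11(v) p.37] -/
theorem isPullbackMorphism_iff_of_square_over (hF : IsFrobenioid F) {A B X Y : C} {φ : A ⟶ B}
    (hφ : IsLinear F φ) {α : X ⟶ A} {β : Y ⟶ B} (hα : IsCoAngularPreStep F α)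
    (hβ : IsCoAngularPreStep F β) (hdiv : invDiv F α hα.2.2 = pull Φ (Base F φ) (invDiv F β hβ.2.2))
    {ψ : X ⟶ Y} (h : ψ ≫ β = α ≫ φ) : IsPullbackMorphism F φ ↔ IsPullbackMorphism F ψ := by
  have hP := hF.isPreFrobenioid
  constructor
  · intro hφpb
    obtain ⟨ψ', hψ', h'⟩ := exists_pullback_square_over hF hφpb α β hα hβ hdiv
    rwa [square_over_unique hF hβ.2 h h']
  · intro hψ
    obtain ⟨⟨hψco, hψiso⟩, hψlin⟩ := hF.iv_b ψ hψ
    -- `α ≫ φ = ψ ≫ β` is co-angular and linear, so `φ` is co-angular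
    have hco : IsCoAngular F φ := by
      have h1 : IsCoAngular F (α ≫ φ) := by rw [← h]; exact hF.iii_a ψ β hψco hβ.1
      have h2 : IsLinear F (α ≫ φ) := IsLinear.comp F hα.2.1 hφ
      exact (isCoAngular_isLinear_factors F hF h1 h2).1.1
    -- `φ` is an isometry: compare zero divisors along the square
    haveI : IsIso (Base F β) := hβ.2.2
    haveI : IsIso (Base F α) := hα.2.2
    have hb : Base F ψ ≫ Base F β = Base F α ≫ Base F φ := by rw [← base_comp, h, base_comp]
    have hDα : Div F α = pull Φ (Base F ψ) (Div F β) := by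
      have e1 : Div F α = pull Φ (Base F α) (invDiv F α hα.2.2) := (pull_invDiv α hα.2.2).symm
      rw [e1, hdiv, ← pull_comp, ← hb]
      show _ = pull Φ (Base F ψ) (Div F β)
      rw [pull_comp, pull_invDiv]
    have hd := congrArg (Div F) h
    rw [div_comp, div_comp, show Div F ψ = 1 from hψiso, one_pow, mul_one, ← hDα,
      show degFr F φ = 1 from hφ, PNat.one_coe, pow_one] at hd
    -- `Div α = Base(α)^* Div φ · Div α`, so `Base(α)^* Div φ = 1`
    have hcancel : IsCancelMul (Φ.obj (op (baseObj F X))) :=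
      isIntegral_iff_isCancelMul.mp (hP.isDivisorial _).isPreDivisorial.isIntegral
    have h1 : pull Φ (Base F α) (Div F φ) * Div F α = 1 * Div F α := by rw [one_mul]; exact hd.symm
    have h2 : pull Φ (Base F α) (Div F φ) = 1 := mul_right_cancel h1
    have hiso : IsIsometry F φ := (hP.isMonoidOn.isCharInjective (Base F α)).1 (by rw [h2, map_one])
    exact (isPullbackMorphism_iff_isLBInvertible_isLinear F hF φ).mpr ⟨⟨hco, hiso⟩, hφ⟩

/-! ### The coslice case ("resp'd") -/

/-- **Prop. 1.11 (v)**, coslice case, `φ` a pull-back morphism: there is a PULL-BACK morphism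
`ψ : X → Y` with `ψ ∘ α = β ∘ φ`. [cite: MochizukiFrdI2008, Prop. 1.11(v) p.38] -/
theorem exists_pullback_square_under (hF : IsFrobenioid F) {A B X Y : C} {φ : A ⟶ B}
    (hφ : IsPullbackMorphism F φ) (α : A ⟶ X) (β : B ⟶ Y) (hα : IsCoAngularPreStep F α)
    (hβ : IsCoAngularPreStep F β) (hdiv : Div F α = pull Φ (Base F φ) (Div F β)) :
    ∃ ψ : X ⟶ Y, IsPullbackMorphism F ψ ∧ α ≫ ψ = φ ≫ β := by
  haveI : IsIso (Base F α) := hα.2.2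
  obtain ⟨⟨hφco, hφiso⟩, hφlin⟩ := hF.iv_b φ hφ
  -- a pull-back morphism `ψ₁ : X₁ → Y` over `(Base α)⁻¹ ≫ Base φ ≫ Base β`
  obtain ⟨X₁, ψ₁, i, hψ₁, hψ₁b⟩ :=
    exists_isPullbackMorphism_over hF Y (inv (Base F α) ≫ Base F φ ≫ Base F β)
  obtain ⟨⟨hψ₁co, hψ₁iso⟩, hψ₁lin⟩ := hF.iv_b ψ₁ hψ₁
  -- lift `φ ≫ β` along `ψ₁`
  obtain ⟨α₁, hα₁, hα₁b⟩ := hψ₁.exists_lift (φ ≫ β) (Base F α ≫ i.inv) (by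
    rw [base_comp, hψ₁b]; simp)
  have hα₁co : IsCoAngularPreStep F α₁ := by
    refine isCoAngularPreStep_of_factors hF (h := ψ₁) ?_ ?_ ?_
    · rw [hα₁]; exact hF.iii_a φ β hφco hβ.1
    · rw [hα₁]; exact IsLinear.comp F hφlin hβ.2.1
    · show IsIso (Base F α₁); rw [hα₁b]; infer_instance
  have hDα₁ : Div F α₁ = Div F α := by
    have h1 : Div F (α₁ ≫ ψ₁) = Div F α₁ := by
      rw [div_comp, show Div F ψ₁ = 1 from hψ₁iso, map_one, one_mul, show degFr F ψ₁ = 1 from hψ₁lin,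
        PNat.one_coe, pow_one]
    have h2 : Div F (φ ≫ β) = pull Φ (Base F φ) (Div F β) := by
      rw [div_comp, show Div F φ = 1 from hφiso, one_pow, mul_one]
    rw [← h1, hα₁, h2, hdiv]
  obtain ⟨e, he⟩ := exists_iso_of_div_eq hF α α₁ hα hα₁co hDα₁.symm
  refine ⟨e.hom ≫ ψ₁, IsPullbackMorphism.comp F (isPullbackMorphism_of_isIso F e.hom) hψ₁, ?_⟩
  rw [← Category.assoc, he, hα₁]

/-- **Prop. 1.11 (v)**, coslice case, `φ` an isometric pre-step: there is a linear `ψ` with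
`ψ ∘ α = β ∘ φ` (Def. 1.3 (v)(b) applied to the pre-step `β ∘ φ`, then (iii)(d)).
[cite: MochizukiFrdI2008, Prop. 1.11(v) p.38] -/
theorem exists_linear_square_under_of_isIsometricPreStep (hF : IsFrobenioid F) {A B X Y : C}
    {φ : A ⟶ B} (hφ : IsIsometricPreStep F φ) (α : A ⟶ X) (β : B ⟶ Y)
    (hα : IsCoAngularPreStep F α) (hβ : IsCoAngularPreStep F β)
    (hdiv : Div F α = pull Φ (Base F φ) (Div F β)) :
    ∃ ψ : X ⟶ Y, IsLinear F ψ ∧ α ≫ ψ = φ ≫ β := by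
  obtain ⟨X', c, j, hcj, hc, hj⟩ := hF.v_b_exists (φ ≫ β) (IsPreStep.comp F hφ.2 hβ.2)
  have hDc : Div F c = Div F α := by
    have h1 : Div F (c ≫ j) = Div F c := by
      rw [div_comp, show Div F j = 1 from hj.1, map_one, one_mul, show degFr F j = 1 from hj.2.1,
        PNat.one_coe, pow_one]
    have h2 : Div F (φ ≫ β) = pull Φ (Base F φ) (Div F β) := by
      rw [div_comp, show Div F φ = 1 from hφ.1, one_pow, mul_one]
    rw [← h1, hcj, h2, hdiv]
  obtain ⟨e, he⟩ := exists_iso_of_div_eq hF α c hα hc hDc.symm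
  refine ⟨e.hom ≫ j, IsLinear.comp F (isLinear_of_isIso F e.hom) hj.2.1, ?_⟩
  rw [← Category.assoc, he, hcj]

/-- **Prop. 1.11 (v)**, coslice case, `φ` a co-angular pre-step: there is a co-angular pre-step
`ψ` with `ψ ∘ α = β ∘ φ` (Def. 1.3 (iii)(d)). [cite: MochizukiFrdI2008, Prop. 1.11(v) p.38] -/
theorem exists_linear_square_under_of_isCoAngularPreStep (hF : IsFrobenioid F) {A B X Y : C}
    {φ : A ⟶ B} (hφ : IsCoAngularPreStep F φ) (α : A ⟶ X) (β : B ⟶ Y)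
    (hα : IsCoAngularPreStep F α) (hβ : IsCoAngularPreStep F β)
    (hdiv : Div F α = pull Φ (Base F φ) (Div F β)) :
    ∃ ψ : X ⟶ Y, IsCoAngularPreStep F ψ ∧ α ≫ ψ = φ ≫ β := by
  have hφβ : IsCoAngularPreStep F (φ ≫ β) := ⟨hF.iii_a φ β hφ.1 hβ.1, IsPreStep.comp F hφ.2 hβ.2⟩
  have hdvd : Div F α ∣ Div F (φ ≫ β) := ⟨Div F φ, by
    rw [div_comp, hdiv, show degFr F β = 1 from hβ.2.1, PNat.one_coe, pow_one]⟩
  exact hF.iii_d_under_full α (φ ≫ β) hα hφβ hdvd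

/-- **Prop. 1.11 (v)**, coslice case, existence for an arbitrary linear `φ`.
[cite: MochizukiFrdI2008, Prop. 1.11(v) p.37] -/
theorem exists_linear_square_under (hF : IsFrobenioid F) {A B X Y : C} {φ : A ⟶ B}
    (hφ : IsLinear F φ) (α : A ⟶ X) (β : B ⟶ Y) (hα : IsCoAngularPreStep F α)
    (hβ : IsCoAngularPreStep F β) (hdiv : Div F α = pull Φ (Base F φ) (Div F β)) :
    ∃ ψ : X ⟶ Y, IsLinear F ψ ∧ α ≫ ψ = φ ≫ β := by
  obtain ⟨A₂, p, q, hpq, hp, hq⟩ := (isLinear_iff_exists_preStep_pullback F hF φ).mp hφ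
  obtain ⟨A₁, c, i, hci, hc, hi⟩ := hF.v_b_exists p hp
  obtain ⟨Y₂, β₂, hβ₂, hβ₂x⟩ := hF.iii_d_under_surj A₂ (pull Φ (Base F q) (Div F β))
  obtain ⟨Y₁, β₁, hβ₁, hβ₁x⟩ := hF.iii_d_under_surj A₁ (pull Φ (Base F i) (Div F β₂))
  have hdiv₁ : Div F α = pull Φ (Base F c) (Div F β₁) := by
    rw [hdiv, hβ₁x, hβ₂x, ← pull_comp, ← pull_comp, ← base_comp, ← base_comp]
    simp only [Category.assoc, reassoc_of% hci, hpq]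
  obtain ⟨ψ₁, hψ₁, h₁⟩ := exists_linear_square_under_of_isCoAngularPreStep hF hc α β₁ hα hβ₁ hdiv₁
  obtain ⟨ψ₂, hψ₂, h₂⟩ := exists_linear_square_under_of_isIsometricPreStep hF hi β₁ β₂ hβ₁ hβ₂ hβ₁x
  obtain ⟨ψ₃, hψ₃, h₃⟩ := exists_pullback_square_under hF hq β₂ β hβ₂ hβ hβ₂x
  refine ⟨ψ₁ ≫ ψ₂ ≫ ψ₃, IsLinear.comp F hψ₁.2.1 (IsLinear.comp F hψ₂ (hF.iv_b ψ₃ hψ₃).2), ?_⟩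
  rw [reassoc_of% h₁, reassoc_of% h₂, h₃, ← hpq, ← hci, Category.assoc, Category.assoc]

/-- **Prop. 1.11 (v)**, coslice case: uniqueness of `ψ` ("from the total epimorphicity of `C`
applied to `α`"). [cite: MochizukiFrdI2008, Prop. 1.11(v) p.38] -/
theorem square_under_unique (hP : IsPreFrobenioid Φ F) {A B X Y : C} {φ : A ⟶ B} {α : A ⟶ X}
    {β : B ⟶ Y} {ψ ψ' : X ⟶ Y} (h : α ≫ ψ = φ ≫ β) (h' : α ≫ ψ' = φ ≫ β) : ψ = ψ' := by
  haveI := hP.isTotallyEpimorphic.epi α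
  exact (cancel_epi α).mp (h.trans h'.symm)

/-- **Prop. 1.11 (v)**, coslice case: existence and uniqueness of the linear `ψ` with
`ψ ∘ α = β ∘ φ`. [cite: MochizukiFrdI2008, Prop. 1.11(v) p.37] -/
theorem existsUnique_linear_square_under (hF : IsFrobenioid F) {A B X Y : C} {φ : A ⟶ B}
    (hφ : IsLinear F φ) (α : A ⟶ X) (β : B ⟶ Y) (hα : IsCoAngularPreStep F α)
    (hβ : IsCoAngularPreStep F β) (hdiv : Div F α = pull Φ (Base F φ) (Div F β)) :
    ∃! ψ : X ⟶ Y, IsLinear F ψ ∧ α ≫ ψ = φ ≫ β := by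
  obtain ⟨ψ, hψ, h⟩ := exists_linear_square_under hF hφ α β hα hβ hdiv
  exact ⟨ψ, ⟨hψ, h⟩, fun ψ' h' => square_under_unique hF.isPreFrobenioid h'.2 h⟩

/-- **Prop. 1.11 (v)**, coslice case, "Moreover, `φ` is a pull-back morphism if and only if `ψ`
is." [cite: MochizukiFrdI2008, Prop. 1.11(v) p.37] -/
theorem isPullbackMorphism_iff_of_square_under (hF : IsFrobenioid F) {A B X Y : C} {φ : A ⟶ B}
    (hφ : IsLinear F φ) {α : A ⟶ X} {β : B ⟶ Y} (hα : IsCoAngularPreStep F α)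
    (hβ : IsCoAngularPreStep F β) (hdiv : Div F α = pull Φ (Base F φ) (Div F β))
    {ψ : X ⟶ Y} (h : α ≫ ψ = φ ≫ β) : IsPullbackMorphism F φ ↔ IsPullbackMorphism F ψ := by
  have hP := hF.isPreFrobenioid
  constructor
  · intro hφpb
    obtain ⟨ψ', hψ', h'⟩ := exists_pullback_square_under hF hφpb α β hα hβ hdiv
    rwa [square_under_unique hP h h']
  · intro hψ
    obtain ⟨⟨hψco, hψiso⟩, hψlin⟩ := hF.iv_b ψ hψ
    have hco : IsCoAngular F φ := by
      have h1 : IsCoAngular F (φ ≫ β) := by rw [← h]; exact hF.iii_a α ψ hα.1 hψco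
      have h2 : IsLinear F (φ ≫ β) := IsLinear.comp F hφ hβ.2.1
      exact (isCoAngular_isLinear_factors F hF h1 h2).2.1
    have hd := congrArg (Div F) h
    rw [div_comp, div_comp, show Div F ψ = 1 from hψiso, map_one, one_mul, show degFr F ψ = 1 from
      hψlin, PNat.one_coe, pow_one, ← hdiv, show degFr F β = 1 from hβ.2.1, PNat.one_coe, pow_one] at hd
    -- `Div α = Base(φ)^* Div β · Div φ = Div α · Div φ`, so `Div φ = 1`
    have hcancel : IsCancelMul (Φ.obj (op (baseObj F A))) :=
      isIntegral_iff_isCancelMul.mp (hP.isDivisorial _).isPreDivisorial.isIntegral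
    have h1 : Div F α * Div F φ = Div F α * 1 := by rw [mul_one]; exact hd.symm
    have hiso : IsIsometry F φ := mul_left_cancel h1
    exact (isPullbackMorphism_iff_isLBInvertible_isLinear F hF φ).mpr ⟨⟨hco, hiso⟩, hφ⟩

end PreFrobenioid

end Literature.AlgebraicGeometry.Frobenioids
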